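import Mathlib
import Literature.Analysis.FluidPDE.GaussianVortexPlanar
import Literature.Analysis.FluidPDE.GaussianVortexPlanarProofs
import Literature.Analysis.FluidPDE.BiotSavart2DSymmetry
import Literature.Analysis.FluidPDE.PineauVicolWeightedIdentity
import Literature.Analysis.FunctionSpaces.BMOLogProofs
import HarnessLib

/-!
# Helper `logPotential_contDiff_one` toward stub `stub_coreInverse` of the line
# `braid-closed-large-circulation-gluing` (crux stmt-AnomalousDissipation-3009, `MarginalStabilityChain.StretchedVortexRows`)

Toolkit for the logarithmic potential `ψ = N ∗ g`, `N(z) = (2π)⁻¹ log ‖z‖`, of a `C¹` density `g` of Gaussian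
class on `ℝ² = EuclideanSpace ℝ (Fin 2)` (wave 3, helper `logPotential_neutral_energy`):

* majorants of the logarithmic kernel (`|log ‖ξ − η‖| ≤ L₀(ξ − η) + log(1 + ‖ξ‖) + ‖η‖`, `L₀ = 𝟙_{‖z‖<1}(−log ‖z‖) ∈ L¹`),
  Gaussian shifts `e^{−‖ξ−η‖²/8} ≤ e^{‖ξ‖²/8} e^{−‖η‖²/16}`, integrability of `|log ‖η‖| e^{−‖η‖²/16}`;
* reduction of the Gaussian-class hypothesis `|g| + ‖Dg‖ ≤ A(1+‖η‖)^k G` to `|g|, ‖Dg‖ ≤ B e^{−‖η‖²/8}`;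
* **`ψ ∈ C¹` with the derivative falling on `g`**: `ψ(ξ) = ∫ N(η) g(ξ − η) dη` (translation invariance), differentiation
  under the integral sign (dominating function `|N(η)| B e^{(‖ξ₀‖+1)²/8} e^{−‖η‖²/16}` on the unit ball about `ξ₀`),
  continuity of the derivative by dominated convergence, `Dψ(ξ)[v] = ∫ N(ξ − η) Dg(η)[v] dη`;
* the crude growth bound `|ψ(ξ)| ≤ C (1 + log(1 + ‖ξ‖))`.
-/

set_option linter.dupNamespace false
noncomputable section
open scoped RealInnerProductSpace Topology
open MeasureTheory WithLp Function Metric Filter Set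

namespace Summit.AnomalousDissipation.AnomalousDissipation.Theorems.MarginalStabilityChainStretchedVortexRows

open Literature.Analysis.FluidPDE

/-! ### Majorants of the logarithmic kernel -/
/-- The local logarithmic majorant `L₀ = 𝟙_{‖z‖<1} (−log ‖z‖)` is nonnegative. [folklore] -/
theorem indicator_neg_log_norm_nonneg (z : EuclideanSpace ℝ (Fin 2)) :
    0 ≤ (ball (0 : EuclideanSpace ℝ (Fin 2)) 1).indicator (fun z => -Real.log ‖z‖) z := by
  refine indicator_nonneg (fun z hz => ?_) z
  rw [mem_ball_zero_iff] at hz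
  have := Real.log_nonpos (norm_nonneg z) hz.le
  linarith

/-- `L₀ = 𝟙_{‖z‖<1} (−log ‖z‖)` is integrable on `ℝ²` (`log ‖z‖ ∈ L¹(B(0,1))` by polar coordinates). [folklore] -/
theorem integrable_indicator_neg_log_norm :
    Integrable ((ball (0 : EuclideanSpace ℝ (Fin 2)) 1).indicator fun z => -Real.log ‖z‖) :=
  ((Literature.Analysis.FunctionSpaces.BMOLog.integrableOn_log_norm_ball
    (E := EuclideanSpace ℝ (Fin 2)) 1).neg).integrable_indicator measurableSet_ball

/-- `|log ‖z‖| ≤ L₀(z) + log(1 + ‖z‖)`. [folklore] -/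
theorem abs_log_norm_le (z : EuclideanSpace ℝ (Fin 2)) :
    |Real.log ‖z‖| ≤ (ball (0 : EuclideanSpace ℝ (Fin 2)) 1).indicator (fun z => -Real.log ‖z‖) z +
      Real.log (1 + ‖z‖) := by
  have h1 : 0 ≤ Real.log (1 + ‖z‖) := Real.log_nonneg (by linarith [norm_nonneg z])
  by_cases hz : ‖z‖ < 1
  · rw [indicator_of_mem (mem_ball_zero_iff.2 hz)]
    have := Real.log_nonpos (norm_nonneg z) hz.le
    rw [abs_of_nonpos this]
    linarith
  · rw [indicator_of_notMem (by rwa [mem_ball_zero_iff]), zero_add]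
    rw [not_lt] at hz
    rw [abs_of_nonneg (Real.log_nonneg hz)]
    exact Real.log_le_log (by linarith) (by linarith)

/-- `log(1 + ‖ξ − η‖) ≤ log(1 + ‖ξ‖) + ‖η‖`. [folklore] -/
theorem log_one_add_norm_sub_le (ξ η : EuclideanSpace ℝ (Fin 2)) :
    Real.log (1 + ‖ξ - η‖) ≤ Real.log (1 + ‖ξ‖) + ‖η‖ := by
  have h0 : 0 < 1 + ‖ξ‖ := by positivity
  have h1 : 0 < 1 + ‖η‖ := by positivity
  have h2 : Real.log (1 + ‖η‖) ≤ ‖η‖ := by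
    have := Real.log_le_sub_one_of_pos h1
    linarith
  calc Real.log (1 + ‖ξ - η‖) ≤ Real.log ((1 + ‖ξ‖) * (1 + ‖η‖)) := by
        refine Real.log_le_log (by positivity) ?_
        nlinarith [norm_sub_le ξ η, norm_nonneg ξ, norm_nonneg η]
    _ = Real.log (1 + ‖ξ‖) + Real.log (1 + ‖η‖) := Real.log_mul h0.ne' h1.ne'
    _ ≤ Real.log (1 + ‖ξ‖) + ‖η‖ := by linarith

/-- The three-term majorant `|log ‖ξ − η‖| ≤ L₀(ξ − η) + log(1 + ‖ξ‖) + ‖η‖`. [folklore] -/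
theorem abs_log_norm_sub_le (ξ η : EuclideanSpace ℝ (Fin 2)) :
    |Real.log ‖ξ - η‖| ≤ (ball (0 : EuclideanSpace ℝ (Fin 2)) 1).indicator (fun z => -Real.log ‖z‖) (ξ - η) +
      Real.log (1 + ‖ξ‖) + ‖η‖ := by
  have h1 := abs_log_norm_le (ξ - η)
  have h2 := log_one_add_norm_sub_le ξ η
  linarith

/-! ### Gaussian weights -/
/-- The shifted Gaussian bound `e^{−‖ξ−η‖²/8} ≤ e^{‖ξ‖²/8} e^{−‖η‖²/16}`. [folklore] -/
theorem exp_neg_norm_sub_sq_le (ξ η : EuclideanSpace ℝ (Fin 2)) :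
    Real.exp (-(1 / 8) * ‖ξ - η‖ ^ 2) ≤ Real.exp ((1 / 8) * ‖ξ‖ ^ 2) * Real.exp (-(1 / 16) * ‖η‖ ^ 2) := by
  rw [← Real.exp_add]
  refine Real.exp_le_exp.2 ?_
  have h : ‖η‖ ≤ ‖ξ‖ + ‖ξ - η‖ := by
    have := norm_sub_le ξ (ξ - η)
    rwa [sub_sub_cancel] at this
  nlinarith [norm_nonneg η, norm_nonneg ξ, norm_nonneg (ξ - η), sq_nonneg (‖ξ‖ - ‖ξ - η‖)]

/-- Polynomial moments of the Gaussian `e^{−‖η‖²/16}` are finite. [folklore] -/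
theorem integrable_one_add_norm_pow_mul_exp_sixteenth (N : ℕ) :
    Integrable fun η : EuclideanSpace ℝ (Fin 2) => (1 + ‖η‖) ^ N * Real.exp (-(1 / 16) * ‖η‖ ^ 2) :=
  PineauVicol2026.integrable_one_add_norm_pow_mul_exp_neg_mul_sq (by norm_num) N
/-- Polynomial moments of the Gaussian `e^{−‖η‖²/8}` are finite. [folklore] -/
theorem integrable_one_add_norm_pow_mul_exp_eighth (N : ℕ) :
    Integrable fun η : EuclideanSpace ℝ (Fin 2) => (1 + ‖η‖) ^ N * Real.exp (-(1 / 8) * ‖η‖ ^ 2) :=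
  PineauVicol2026.integrable_one_add_norm_pow_mul_exp_neg_mul_sq (by norm_num) N

/-- `|log ‖η‖| e^{−‖η‖²/16}` is integrable on `ℝ²`. [folklore] -/
theorem integrable_abs_log_norm_mul_exp :
    Integrable fun η : EuclideanSpace ℝ (Fin 2) => |Real.log ‖η‖| * Real.exp (-(1 / 16) * ‖η‖ ^ 2) := by
  have hmeas : AEStronglyMeasurable
      (fun η : EuclideanSpace ℝ (Fin 2) => |Real.log ‖η‖| * Real.exp (-(1 / 16) * ‖η‖ ^ 2)) volume :=
    ((measurable_norm.log.abs).mul (by fun_prop : Measurable fun η : EuclideanSpace ℝ (Fin 2) =>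
      Real.exp (-(1 / 16) * ‖η‖ ^ 2))).aestronglyMeasurable
  refine (integrable_indicator_neg_log_norm.add (integrable_one_add_norm_pow_mul_exp_sixteenth 1)).mono'
    hmeas (Eventually.of_forall fun η => ?_)
  rw [Real.norm_of_nonneg (by positivity), Pi.add_apply, pow_one]
  have h1 := abs_log_norm_le η
  have h2 : Real.log (1 + ‖η‖) ≤ ‖η‖ := by
    have := Real.log_le_sub_one_of_pos (by positivity : (0:ℝ) < 1 + ‖η‖)
    linarith
  have he : Real.exp (-(1 / 16) * ‖η‖ ^ 2) ≤ 1 := Real.exp_le_one_iff.2 (by nlinarith [norm_nonneg η])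
  have h0 := indicator_neg_log_norm_nonneg η
  have he0 : 0 ≤ Real.exp (-(1 / 16) * ‖η‖ ^ 2) := (Real.exp_pos _).le
  calc |Real.log ‖η‖| * Real.exp (-(1 / 16) * ‖η‖ ^ 2)
      ≤ ((ball (0 : EuclideanSpace ℝ (Fin 2)) 1).indicator (fun z => -Real.log ‖z‖) η + ‖η‖) *
          Real.exp (-(1 / 16) * ‖η‖ ^ 2) := by gcongr; linarith
    _ = (ball (0 : EuclideanSpace ℝ (Fin 2)) 1).indicator (fun z => -Real.log ‖z‖) η *
          Real.exp (-(1 / 16) * ‖η‖ ^ 2) + ‖η‖ * Real.exp (-(1 / 16) * ‖η‖ ^ 2) := by ring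
    _ ≤ (ball (0 : EuclideanSpace ℝ (Fin 2)) 1).indicator (fun z => -Real.log ‖z‖) η * 1 +
          (1 + ‖η‖) * Real.exp (-(1 / 16) * ‖η‖ ^ 2) := by
        gcongr
        linarith
    _ = _ := by ring

/-! ### Reduction of the Gaussian class `|g| + ‖Dg‖ ≤ A (1 + ‖η‖)^k G` -/

/-- `(1 + ‖η‖)^k G(η) ≤ K_k e^{−‖η‖²/8}` for some `K_k > 0`. [folklore] -/
theorem exists_one_add_norm_pow_mul_gaussVortexProfile_le (k : ℕ) :
    ∃ K : ℝ, 0 < K ∧ ∀ η : EuclideanSpace ℝ (Fin 2),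
      (1 + ‖η‖) ^ k * gaussVortexProfile η ≤ K * Real.exp (-(1 / 8) * ‖η‖ ^ 2) := by
  refine ⟨(4 * Real.pi)⁻¹ * (k.factorial * (4 / (1 / 4)) ^ k * Real.exp ((1 / 4) / 2)), by positivity,
    fun η => ?_⟩
  have h := PineauVicol2026.one_add_pow_mul_exp_neg_mul_sq_le (c := 1 / 4) (by norm_num) k (norm_nonneg η)
  have hG : gaussVortexProfile η = (4 * Real.pi)⁻¹ * Real.exp (-(1 / 4) * ‖η‖ ^ 2) := by
    rw [gaussVortexProfile]; congr 1; congr 1; ring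
  have e : -((1 / 4 : ℝ) / 2) * ‖η‖ ^ 2 = -(1 / 8) * ‖η‖ ^ 2 := by ring
  rw [e] at h
  rw [hG]
  calc (1 + ‖η‖) ^ k * ((4 * Real.pi)⁻¹ * Real.exp (-(1 / 4) * ‖η‖ ^ 2))
      = (4 * Real.pi)⁻¹ * ((1 + ‖η‖) ^ k * Real.exp (-(1 / 4) * ‖η‖ ^ 2)) := by ring
    _ ≤ (4 * Real.pi)⁻¹ * ((k.factorial * (4 / (1 / 4)) ^ k * Real.exp ((1 / 4) / 2)) *
          Real.exp (-(1 / 8) * ‖η‖ ^ 2)) := by gcongr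
    _ = _ := by ring

/-- Reduction of the Gaussian-class hypothesis to pure Gaussian bounds `|g|, ‖Dg‖ ≤ B e^{−‖η‖²/8}`. [folklore] -/
theorem gaussClass_reduce {k : ℕ} {A : ℝ} {g : EuclideanSpace ℝ (Fin 2) → ℝ}
    (hb : ∀ η, |g η| + ‖fderiv ℝ g η‖ ≤ A * (1 + ‖η‖) ^ k * gaussVortexProfile η) :
    ∃ B : ℝ, 0 ≤ B ∧ (∀ η, |g η| ≤ B * Real.exp (-(1 / 8) * ‖η‖ ^ 2)) ∧
      ∀ η, ‖fderiv ℝ g η‖ ≤ B * Real.exp (-(1 / 8) * ‖η‖ ^ 2) := by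
  obtain ⟨K, hK, hKb⟩ := exists_one_add_norm_pow_mul_gaussVortexProfile_le k
  have hA : 0 ≤ A := by
    have h := hb 0
    have h1 : 0 ≤ |g 0| + ‖fderiv ℝ g 0‖ := by positivity
    have h2 : 0 < (1 + ‖(0 : EuclideanSpace ℝ (Fin 2))‖) ^ k * gaussVortexProfile 0 :=
      mul_pos (by positivity) (gaussVortexProfile_pos 0)
    by_contra hA
    have : A * (1 + ‖(0 : EuclideanSpace ℝ (Fin 2))‖) ^ k * gaussVortexProfile 0 < 0 := by
      rw [mul_assoc]; exact mul_neg_of_neg_of_pos (not_le.1 hA) h2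
    linarith
  have hmain : ∀ η, |g η| + ‖fderiv ℝ g η‖ ≤ A * K * Real.exp (-(1 / 8) * ‖η‖ ^ 2) := fun η =>
    calc |g η| + ‖fderiv ℝ g η‖ ≤ A * ((1 + ‖η‖) ^ k * gaussVortexProfile η) := by
          rw [← mul_assoc]; exact hb η
      _ ≤ A * (K * Real.exp (-(1 / 8) * ‖η‖ ^ 2)) := mul_le_mul_of_nonneg_left (hKb η) hA
      _ = _ := by ring
  refine ⟨A * K, by positivity, fun η => ?_, fun η => ?_⟩
  · exact le_trans (le_add_of_nonneg_right (norm_nonneg _)) (hmain η)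
  · exact le_trans (le_add_of_nonneg_left (abs_nonneg _)) (hmain η)

/-! ### `ψ = N ∗ g` is `C¹`, with the derivative falling on `g` -/

section Potential

variable {B : ℝ} {g : EuclideanSpace ℝ (Fin 2) → ℝ} (hg : ContDiff ℝ 1 g)
  (hg0 : ∀ η, |g η| ≤ B * Real.exp (-(1 / 8) * ‖η‖ ^ 2))
  (hg1 : ∀ η, ‖fderiv ℝ g η‖ ≤ B * Real.exp (-(1 / 8) * ‖η‖ ^ 2))

/-- Translation invariance: `∫ N(ξ − η) h(η) dη = ∫ N(η) h(ξ − η) dη`. [folklore] -/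
theorem integral_logKernel_comm (h : EuclideanSpace ℝ (Fin 2) → ℝ) (ξ : EuclideanSpace ℝ (Fin 2)) :
    ∫ η, (2 * Real.pi)⁻¹ * Real.log ‖ξ - η‖ * h η = ∫ η, (2 * Real.pi)⁻¹ * Real.log ‖η‖ * h (ξ - η) := by
  have h1 := integral_sub_left_eq_self (fun η => (2 * Real.pi)⁻¹ * Real.log ‖ξ - η‖ * h η) volume ξ
  simp only [sub_sub_cancel] at h1
  exact h1.symm

/-- The local Gaussian shift on the unit ball about `ξ₀`:
`B e^{−‖ξ−η‖²/8} ≤ B e^{(‖ξ₀‖+1)²/8} e^{−‖η‖²/16}` for `‖ξ − ξ₀‖ < 1`. [folklore] -/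
theorem gaussBound_shift_le (hB : 0 ≤ B) {ξ₀ ξ : EuclideanSpace ℝ (Fin 2)} (hξ : ξ ∈ ball ξ₀ 1)
    (η : EuclideanSpace ℝ (Fin 2)) :
    B * Real.exp (-(1 / 8) * ‖ξ - η‖ ^ 2) ≤
      B * Real.exp ((1 / 8) * (‖ξ₀‖ + 1) ^ 2) * Real.exp (-(1 / 16) * ‖η‖ ^ 2) := by
  have h1 := exp_neg_norm_sub_sq_le ξ η
  have hξ' : ‖ξ‖ ≤ ‖ξ₀‖ + 1 := by
    rw [mem_ball_iff_norm] at hξ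
    have := norm_le_norm_add_norm_sub' ξ ξ₀
    linarith
  have h2 : Real.exp ((1 / 8) * ‖ξ‖ ^ 2) ≤ Real.exp ((1 / 8) * (‖ξ₀‖ + 1) ^ 2) :=
    Real.exp_le_exp.2 (by nlinarith [norm_nonneg ξ])
  calc B * Real.exp (-(1 / 8) * ‖ξ - η‖ ^ 2)
      ≤ B * (Real.exp ((1 / 8) * ‖ξ‖ ^ 2) * Real.exp (-(1 / 16) * ‖η‖ ^ 2)) :=
        mul_le_mul_of_nonneg_left h1 hB
    _ ≤ B * (Real.exp ((1 / 8) * (‖ξ₀‖ + 1) ^ 2) * Real.exp (-(1 / 16) * ‖η‖ ^ 2)) := by gcongr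
    _ = _ := by ring

include hg1 in
/-- The dominating function for the differentiated integrand `N(η) Dg(ξ − η)` on the unit ball about `ξ₀`. [folklore] -/
theorem norm_logKernel_smul_fderiv_le (hB : 0 ≤ B) {ξ₀ ξ : EuclideanSpace ℝ (Fin 2)} (hξ : ξ ∈ ball ξ₀ 1)
    (η : EuclideanSpace ℝ (Fin 2)) :
    ‖((2 * Real.pi)⁻¹ * Real.log ‖η‖) • fderiv ℝ g (ξ - η)‖ ≤
      |Real.log ‖η‖| * Real.exp (-(1 / 16) * ‖η‖ ^ 2) *
        ((2 * Real.pi)⁻¹ * B * Real.exp ((1 / 8) * (‖ξ₀‖ + 1) ^ 2)) := by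
  rw [norm_smul, Real.norm_eq_abs, abs_mul, abs_of_pos (by positivity : (0:ℝ) < (2 * Real.pi)⁻¹)]
  have h := (hg1 (ξ - η)).trans (gaussBound_shift_le hB hξ η)
  calc (2 * Real.pi)⁻¹ * |Real.log ‖η‖| * ‖fderiv ℝ g (ξ - η)‖
      ≤ (2 * Real.pi)⁻¹ * |Real.log ‖η‖| *
          (B * Real.exp ((1 / 8) * (‖ξ₀‖ + 1) ^ 2) * Real.exp (-(1 / 16) * ‖η‖ ^ 2)) := by gcongr
    _ = _ := by ring

include hg in
/-- Measurability of the differentiated integrand. [folklore] -/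
theorem aestronglyMeasurable_logKernel_smul_fderiv (ξ : EuclideanSpace ℝ (Fin 2)) :
    AEStronglyMeasurable (fun η : EuclideanSpace ℝ (Fin 2) =>
      ((2 * Real.pi)⁻¹ * Real.log ‖η‖) • fderiv ℝ g (ξ - η)) volume :=
  (measurable_const.mul measurable_norm.log).aestronglyMeasurable.smul
    (((hg.continuous_fderiv one_ne_zero).comp (continuous_const.sub continuous_id)).aestronglyMeasurable)

include hg hg0 hg1 in
/-- **Differentiation under the integral sign**: `ψ(ξ) = ∫ N(η) g(ξ − η) dη` has the Fréchet derivative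
`∫ N(η) Dg(ξ₀ − η) dη` at `ξ₀`, the integrand of which is integrable. [folklore] -/
theorem hasFDerivAt_logPotential (ξ₀ : EuclideanSpace ℝ (Fin 2)) :
    Integrable (fun η : EuclideanSpace ℝ (Fin 2) => ((2 * Real.pi)⁻¹ * Real.log ‖η‖) • fderiv ℝ g (ξ₀ - η)) ∧
      HasFDerivAt (fun ξ : EuclideanSpace ℝ (Fin 2) => ∫ η, (2 * Real.pi)⁻¹ * Real.log ‖ξ - η‖ * g η)
        (∫ η, ((2 * Real.pi)⁻¹ * Real.log ‖η‖) • fderiv ℝ g (ξ₀ - η)) ξ₀ := by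
  have hB : 0 ≤ B := (abs_nonneg _).trans ((hg0 0).trans (le_of_eq (by simp)))
  have hfun : (fun ξ : EuclideanSpace ℝ (Fin 2) => ∫ η, (2 * Real.pi)⁻¹ * Real.log ‖ξ - η‖ * g η) =
      fun ξ => ∫ η, (2 * Real.pi)⁻¹ * Real.log ‖η‖ * g (ξ - η) := funext (integral_logKernel_comm g)
  rw [hfun]
  set bound : EuclideanSpace ℝ (Fin 2) → ℝ := fun η => |Real.log ‖η‖| * Real.exp (-(1 / 16) * ‖η‖ ^ 2) *
    ((2 * Real.pi)⁻¹ * B * Real.exp ((1 / 8) * (‖ξ₀‖ + 1) ^ 2)) with hbound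
  have hbound_int : Integrable bound := integrable_abs_log_norm_mul_exp.mul_const _
  have hgc : Continuous g := hg.continuous
  have hmeasF : ∀ ξ : EuclideanSpace ℝ (Fin 2), AEStronglyMeasurable
      (fun η : EuclideanSpace ℝ (Fin 2) => (2 * Real.pi)⁻¹ * Real.log ‖η‖ * g (ξ - η)) volume := fun ξ =>
    ((measurable_const.mul measurable_norm.log).mul
      (hgc.measurable.comp (measurable_const.sub measurable_id))).aestronglyMeasurable
  have hF'bound : ∀ ξ ∈ ball ξ₀ 1, ∀ η,
      ‖((2 * Real.pi)⁻¹ * Real.log ‖η‖) • fderiv ℝ g (ξ - η)‖ ≤ bound η := fun ξ hξ η =>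
    norm_logKernel_smul_fderiv_le hg1 hB hξ η
  refine ⟨hbound_int.mono' (aestronglyMeasurable_logKernel_smul_fderiv hg ξ₀)
    (Eventually.of_forall (hF'bound ξ₀ (mem_ball_self one_pos))), ?_⟩
  refine hasFDerivAt_integral_of_dominated_of_fderiv_le
    (F' := fun (ξ : EuclideanSpace ℝ (Fin 2)) (η : EuclideanSpace ℝ (Fin 2)) =>
      ((2 * Real.pi)⁻¹ * Real.log ‖η‖) • fderiv ℝ g (ξ - η))
    (ball_mem_nhds ξ₀ one_pos) (Eventually.of_forall hmeasF) ?_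
    (aestronglyMeasurable_logKernel_smul_fderiv hg ξ₀)
    (Eventually.of_forall fun η ξ hξ => hF'bound ξ hξ η) hbound_int (Eventually.of_forall fun η ξ _ => ?_)
  · refine hbound_int.mono' (hmeasF ξ₀) (Eventually.of_forall fun η => ?_)
    rw [Real.norm_eq_abs, abs_mul, abs_mul, abs_of_pos (by positivity : (0:ℝ) < (2 * Real.pi)⁻¹)]
    have h := (hg0 (ξ₀ - η)).trans (gaussBound_shift_le hB (mem_ball_self one_pos) η)
    calc (2 * Real.pi)⁻¹ * |Real.log ‖η‖| * |g (ξ₀ - η)|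
        ≤ (2 * Real.pi)⁻¹ * |Real.log ‖η‖| *
            (B * Real.exp ((1 / 8) * (‖ξ₀‖ + 1) ^ 2) * Real.exp (-(1 / 16) * ‖η‖ ^ 2)) := by gcongr
      _ = bound η := by simp only [hbound]; ring
  · have h1 : HasFDerivAt (fun ξ : EuclideanSpace ℝ (Fin 2) => g (ξ - η)) (fderiv ℝ g (ξ - η)) ξ := by
      have := ((hg.differentiable one_ne_zero) (ξ - η)).hasFDerivAt.comp ξ (hasFDerivAt_sub_const η)
      rw [ContinuousLinearMap.comp_id] at this
      exact this
    exact h1.const_mul ((2 * Real.pi)⁻¹ * Real.log ‖η‖)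

include hg hg0 hg1 in
/-- **`ψ = N ∗ g` is `C¹` and `Dψ(ξ)[v] = ∫ N(ξ − η) Dg(η)[v] dη`** for a `C¹` density with Gaussian bounds on
`g` and `Dg` (registered helper toward `logPotential_neutral_energy`). [folklore] -/
theorem contDiff_one_logPotential_of_gaussBound :
    ContDiff ℝ 1 (fun ξ : EuclideanSpace ℝ (Fin 2) => ∫ η, (2 * Real.pi)⁻¹ * Real.log ‖ξ - η‖ * g η) ∧
      ∀ ξ v : EuclideanSpace ℝ (Fin 2),
        fderiv ℝ (fun ξ : EuclideanSpace ℝ (Fin 2) => ∫ η, (2 * Real.pi)⁻¹ * Real.log ‖ξ - η‖ * g η) ξ v =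
          ∫ η, (2 * Real.pi)⁻¹ * Real.log ‖ξ - η‖ * fderiv ℝ g η v := by
  have hB : 0 ≤ B := (abs_nonneg _).trans ((hg0 0).trans (le_of_eq (by simp)))
  have hD := fun ξ₀ => hasFDerivAt_logPotential hg hg0 hg1 ξ₀
  have hderiv : fderiv ℝ (fun ξ : EuclideanSpace ℝ (Fin 2) => ∫ η, (2 * Real.pi)⁻¹ * Real.log ‖ξ - η‖ * g η) =
      fun ξ => ∫ η, ((2 * Real.pi)⁻¹ * Real.log ‖η‖) • fderiv ℝ g (ξ - η) :=
    funext fun ξ => (hD ξ).2.fderiv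
  refine ⟨?_, fun ξ v => ?_⟩
  · rw [contDiff_one_iff_fderiv]
    refine ⟨fun ξ => (hD ξ).2.differentiableAt, ?_⟩
    rw [hderiv]
    refine continuous_iff_continuousAt.2 fun ξ₀ => ?_
    refine continuousAt_of_dominated (Eventually.of_forall (aestronglyMeasurable_logKernel_smul_fderiv hg))
      ?_ (integrable_abs_log_norm_mul_exp.mul_const
        ((2 * Real.pi)⁻¹ * B * Real.exp ((1 / 8) * (‖ξ₀‖ + 1) ^ 2))) (Eventually.of_forall fun η => ?_)
    · filter_upwards [ball_mem_nhds ξ₀ one_pos] with ξ hξ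
      exact Eventually.of_forall fun η => norm_logKernel_smul_fderiv_le hg1 hB hξ η
    · have hc : Continuous fun x : EuclideanSpace ℝ (Fin 2) => fderiv ℝ g (x - η) :=
        (hg.continuous_fderiv one_ne_zero).comp (continuous_id.sub continuous_const)
      exact (hc.const_smul ((2 * Real.pi)⁻¹ * Real.log ‖η‖)).continuousAt
  · rw [hderiv]
    dsimp only
    rw [ContinuousLinearMap.integral_apply (hD ξ).1 v]
    simp only [FunLike.coe_smul, Pi.smul_apply, smul_eq_mul]
    exact (integral_logKernel_comm (fun η => fderiv ℝ g η v) ξ).symm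

include hg0 in
/-- **Crude growth bound**: `|ψ(ξ)| ≤ C (1 + log(1 + ‖ξ‖))` for a density with `|g| ≤ B e^{−‖η‖²/8}`
(`|log ‖ξ−η‖| ≤ L₀(ξ−η) + log(1+‖ξ‖) + ‖η‖`, `L₀ ∈ L¹`, Gaussian moments). [folklore] -/
theorem abs_logPotential_le :
    ∃ C : ℝ, 0 ≤ C ∧ ∀ ξ : EuclideanSpace ℝ (Fin 2),
      |∫ η, (2 * Real.pi)⁻¹ * Real.log ‖ξ - η‖ * g η| ≤ C * (1 + Real.log (1 + ‖ξ‖)) := by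
  have hB : 0 ≤ B := (abs_nonneg _).trans ((hg0 0).trans (le_of_eq (by simp)))
  set I₀ : ℝ := ∫ z, (ball (0 : EuclideanSpace ℝ (Fin 2)) 1).indicator (fun z => -Real.log ‖z‖) z with hI₀def
  set I₂ : ℝ := ∫ η : EuclideanSpace ℝ (Fin 2), (1 + ‖η‖) ^ 1 * Real.exp (-(1 / 8) * ‖η‖ ^ 2) with hI₂def
  have hI₀ : 0 ≤ I₀ := integral_nonneg indicator_neg_log_norm_nonneg
  have hI₂ : 0 ≤ I₂ := integral_nonneg fun η => by positivity
  refine ⟨(2 * Real.pi)⁻¹ * B * (I₀ + I₂), by positivity, fun ξ => ?_⟩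
  have hc : (0:ℝ) ≤ (2 * Real.pi)⁻¹ := by positivity
  have hL : 0 ≤ Real.log (1 + ‖ξ‖) := Real.log_nonneg (by linarith [norm_nonneg ξ])
  have hi0 : Integrable fun η : EuclideanSpace ℝ (Fin 2) =>
      (ball (0 : EuclideanSpace ℝ (Fin 2)) 1).indicator (fun z => -Real.log ‖z‖) (ξ - η) :=
    integrable_indicator_neg_log_norm.comp_sub_left ξ
  have hi2 := integrable_one_add_norm_pow_mul_exp_eighth 1
  set F : EuclideanSpace ℝ (Fin 2) → ℝ := fun η => (2 * Real.pi)⁻¹ * B *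
    ((ball (0 : EuclideanSpace ℝ (Fin 2)) 1).indicator (fun z => -Real.log ‖z‖) (ξ - η) +
      Real.log (1 + ‖ξ‖) * ((1 + ‖η‖) ^ 1 * Real.exp (-(1 / 8) * ‖η‖ ^ 2)) +
      (1 + ‖η‖) ^ 1 * Real.exp (-(1 / 8) * ‖η‖ ^ 2)) with hF
  have hi1 : Integrable fun η : EuclideanSpace ℝ (Fin 2) =>
      Real.log (1 + ‖ξ‖) * ((1 + ‖η‖) ^ 1 * Real.exp (-(1 / 8) * ‖η‖ ^ 2)) := hi2.const_mul _
  have hi01 : Integrable fun η : EuclideanSpace ℝ (Fin 2) =>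
      (ball (0 : EuclideanSpace ℝ (Fin 2)) 1).indicator (fun z => -Real.log ‖z‖) (ξ - η) +
        Real.log (1 + ‖ξ‖) * ((1 + ‖η‖) ^ 1 * Real.exp (-(1 / 8) * ‖η‖ ^ 2)) := hi0.add hi1
  have hFint : Integrable F := (hi01.add hi2).const_mul _
  have hFI : ∫ η, F η = (2 * Real.pi)⁻¹ * B * (I₀ + Real.log (1 + ‖ξ‖) * I₂ + I₂) := by
    simp only [hF]
    rw [integral_const_mul, integral_add hi01 hi2, integral_add hi0 hi1, integral_const_mul,
      integral_sub_left_eq_self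
        ((ball (0 : EuclideanSpace ℝ (Fin 2)) 1).indicator (fun z => -Real.log ‖z‖)) volume ξ]
  have hpt : ∀ η, ‖(2 * Real.pi)⁻¹ * Real.log ‖ξ - η‖ * g η‖ ≤ F η := by
    intro η
    rw [Real.norm_eq_abs, abs_mul, abs_mul, abs_of_nonneg hc]
    have h1 := abs_log_norm_sub_le ξ η
    have h2 := hg0 η
    have h3 : Real.exp (-(1 / 8) * ‖η‖ ^ 2) ≤ 1 := Real.exp_le_one_iff.2 (by nlinarith [norm_nonneg η])
    have h4 := indicator_neg_log_norm_nonneg (ξ - η)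
    have h5 : (0:ℝ) ≤ Real.exp (-(1 / 8) * ‖η‖ ^ 2) := (Real.exp_pos _).le
    set L0 := (ball (0 : EuclideanSpace ℝ (Fin 2)) 1).indicator (fun z => -Real.log ‖z‖) (ξ - η) with hL0
    set e := Real.exp (-(1 / 8) * ‖η‖ ^ 2) with he
    have h6 : 0 ≤ L0 + Real.log (1 + ‖ξ‖) + ‖η‖ := by positivity
    have i1 : L0 * e ≤ L0 := mul_le_of_le_one_right h4 h3
    have i2 : Real.log (1 + ‖ξ‖) * e ≤ Real.log (1 + ‖ξ‖) * ((1 + ‖η‖) ^ 1 * e) :=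
      mul_le_mul_of_nonneg_left (by rw [pow_one]; nlinarith [norm_nonneg η]) hL
    have i3 : ‖η‖ * e ≤ (1 + ‖η‖) ^ 1 * e := by rw [pow_one]; nlinarith
    calc (2 * Real.pi)⁻¹ * |Real.log ‖ξ - η‖| * |g η|
        ≤ (2 * Real.pi)⁻¹ * (L0 + Real.log (1 + ‖ξ‖) + ‖η‖) * (B * e) :=
          mul_le_mul (mul_le_mul_of_nonneg_left h1 hc) h2 (abs_nonneg _) (mul_nonneg hc h6)
      _ = (2 * Real.pi)⁻¹ * B * (L0 * e + Real.log (1 + ‖ξ‖) * e + ‖η‖ * e) := by ring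
      _ ≤ (2 * Real.pi)⁻¹ * B * (L0 + Real.log (1 + ‖ξ‖) * ((1 + ‖η‖) ^ 1 * e) + (1 + ‖η‖) ^ 1 * e) :=
          mul_le_mul_of_nonneg_left (by linarith) (mul_nonneg hc hB)
      _ = F η := by simp only [hF, hL0, he]
  calc |∫ η, (2 * Real.pi)⁻¹ * Real.log ‖ξ - η‖ * g η|
      = ‖∫ η, (2 * Real.pi)⁻¹ * Real.log ‖ξ - η‖ * g η‖ := (Real.norm_eq_abs _).symm
    _ ≤ ∫ η, F η := norm_integral_le_of_norm_le hFint (Eventually.of_forall hpt)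
    _ = (2 * Real.pi)⁻¹ * B * (I₀ + Real.log (1 + ‖ξ‖) * I₂ + I₂) := hFI
    _ ≤ (2 * Real.pi)⁻¹ * B * ((I₀ + I₂) * (1 + Real.log (1 + ‖ξ‖))) :=
        mul_le_mul_of_nonneg_left (by nlinarith) (mul_nonneg hc hB)
    _ = _ := by ring

end Potential

/-! ### The registered helper -/

/-- **`ψ = N ∗ g ∈ C¹(ℝ²)` with `Dψ(ξ)[v] = ∫ N(ξ − η) Dg(η)[v] dη`** (`N = (2π)⁻¹ log ‖·‖`) for every `C¹` density `g`
with Gaussian bounds `|g|, ‖Dg‖ ≤ B e^{−‖η‖²/8}` (registered helper toward `logPotential_neutral_energy` / `stub_coreInverse`;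
differentiation under the integral sign after moving the variable onto `g`). [folklore] -/
theorem logPotential_contDiff_one :
    ∀ (B : ℝ) (g : EuclideanSpace ℝ (Fin 2) → ℝ), ContDiff ℝ 1 g →
      (∀ η, |g η| ≤ B * Real.exp (-(1 / 8) * ‖η‖ ^ 2)) →
      (∀ η, ‖fderiv ℝ g η‖ ≤ B * Real.exp (-(1 / 8) * ‖η‖ ^ 2)) →
      ContDiff ℝ 1 (fun ξ : EuclideanSpace ℝ (Fin 2) => ∫ η, (2 * Real.pi)⁻¹ * Real.log ‖ξ - η‖ * g η) ∧
        ∀ ξ v : EuclideanSpace ℝ (Fin 2),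
          fderiv ℝ (fun ξ : EuclideanSpace ℝ (Fin 2) => ∫ η, (2 * Real.pi)⁻¹ * Real.log ‖ξ - η‖ * g η) ξ v =
            ∫ η, (2 * Real.pi)⁻¹ * Real.log ‖ξ - η‖ * fderiv ℝ g η v :=
  fun _ _ hg hg0 hg1 => contDiff_one_logPotential_of_gaussBound hg hg0 hg1

end Summit.AnomalousDissipation.AnomalousDissipation.Theorems.MarginalStabilityChainStretchedVortexRows

end
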